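import Literature.AlgebraicGeometry.AbelianSchemes.DualPairOfGluedHatUnique
import HarnessLib

/-!
# (Z3) FILE P-a, step (a0): the product charts of `A ×_S H` are CARTESIAN over the hat charts and OPEN IMMERSIONS

Layer `Literature/AlgebraicGeometry/AbelianSchemes`, namespace `Literature.AlgebraicGeometry.AbelianSchemes.AbelianSchemeOver`.
THEOREMS ONLY (no definition, no named fact, no instance, no notation, no `sorry`).  Cell hodgecm-mathlib (D-0151), FLOOR 0 P1
sub-line `Cruxes/HDel/Lines/F3DualAbelianScheme.lean` stub (Z) `stub_F3Z`; FILE P-a step (a0) of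
`B-provers/B-p06/g14/F3/SOCKETS-F3Z-FileP.B-p06g14.md` (B-p06 (g14)): the geometry of the cover of `X := A ×_S H` by the product charts
`Ξᵢ : Aᵢ ×_{Uᵢ} Êᵢ → A ×_S H` (★-shaped `prodChart`) that the (Z1) glueing engine (`Modules/ModuleZariskiGluing`) is fed with.

* **`isPullback_prodChart`** — the square `Ξᵢ ∕ χᵢ` over the projections to `Êᵢ ∕ H` is CARTESIAN: `Aᵢ ×_{Uᵢ} Êᵢ ≅ (A ×_S H) ×_H Êᵢ`
  (paste `Aᵢ ×_{Uᵢ} Êᵢ → Aᵢ → A` over `Êᵢ → Uᵢ → S`, Mathlib `IsPullback.paste_vert`, and cancel the bottom square `A ×_S H → A` over `H → S`,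
  Mathlib `IsPullback.of_bot`);
* **`isOpenImmersion_chart`**, **`isOpenImmersion_prodChart`** — `χᵢ` (a base change of `Uᵢ ↪ S`) and `Ξᵢ` (a base change of `χᵢ`) are open
  immersions (Mathlib `MorphismProperty.of_isPullback`); so `(range Ξᵢ)ᵢ` is an open cover of `A ×_S H` as soon as the `χᵢ` cover `H`;
* `exists_chart_base_eq` — the `χᵢ` cover `H`; `exists_prodChart_base_eq(')`, `exists_mem_opensRange_prodChart` — the `Ξᵢ` cover `A ×_S H`
  (the `hcov` input of the (Z1) engine for `U i := (Ξᵢ).opensRange`).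

HC_CM is proved only modulo the 7 printed citations until rung 0 closes; this file discharges none of them (count-neutral capital).

## References
* [GortzWedhorn2020] U. Görtz, T. Wedhorn, *Algebraic Geometry I*, 2nd ed. (2020), Prop. 4.16 (p. 101) (pasting of fibre products), Section (4.11)
  (base change of open immersions).
* [MumfordFogartyKirwan1994] D. Mumford, J. Fogarty, F. Kirwan, *Geometric Invariant Theory*, 3rd ed. (1994), Ch. 6 §1 Cor. 6.8 (p. 118).
-/

set_option autoImplicit false

-- `Scheme.Modules` / the `Over`-structure maps of ★ `baseChange` are not reducible (as in ★ `PoincareUniversalLocality`).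
set_option backward.isDefEq.respectTransparency false

noncomputable section

universe u

open CategoryTheory CategoryTheory.Limits AlgebraicGeometry MonoidalCategory
open Literature.AlgebraicGeometry.Motives Literature.AlgebraicGeometry.AbelianVarieties Literature.AlgebraicGeometry.Modules

namespace Literature.AlgebraicGeometry.AbelianSchemes

namespace AbelianSchemeOver

variable {S : Scheme.{u}} (A : AbelianSchemeOver S) (𝒰 : Scheme.OpenCover.{u} S)
  (E : ∀ i, (A.baseChange (𝒰.f i)).DualPair) (H : AbelianSchemeOver S) (χ : ∀ i, (E i).hat.X.left ⟶ H.X.left)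
  (hχ : ∀ i, (E i).hat.IsBaseChangeVia H (𝒰.f i) (χ i))

/-- **The product chart is CARTESIAN over the hat chart**: the square with top `pr : Aᵢ ×_{Uᵢ} Êᵢ → Êᵢ`, left `Ξᵢ`, right `χᵢ`, bottom
`pr_H : A ×_S H → H` is a pullback square (`Aᵢ ×_{Uᵢ} Êᵢ ≅ A ×_S Êᵢ ≅ (A ×_S H) ×_H Êᵢ`). [cite: GortzWedhorn2020, Prop. 4.16 (p. 101)] -/
theorem isPullback_prodChart (i : 𝒰.I₀) :
    IsPullback (pullback.snd (A.baseChange (𝒰.f i)).X.hom (E i).hat.X.hom) (A.prodChart 𝒰 E H χ hχ i) (χ i)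
      (pullback.snd A.X.hom H.X.hom) := by
  have w : χ i ≫ H.X.hom = (E i).hat.X.hom ≫ 𝒰.f i := (hχ i).fst
  -- `Aᵢ ×_{Uᵢ} Êᵢ → Aᵢ → A` over `Êᵢ → Uᵢ → S` is cartesian (paste of the two defining squares)
  have α : IsPullback (pullback.snd (A.baseChange (𝒰.f i)).X.hom (E i).hat.X.hom)
      (pullback.fst (A.baseChange (𝒰.f i)).X.hom (E i).hat.X.hom) (E i).hat.X.hom (A.baseChange (𝒰.f i)).X.hom :=
    (IsPullback.of_hasPullback _ _).flip
  have β : IsPullback (pullback.snd A.X.hom (𝒰.f i)) (pullback.fst A.X.hom (𝒰.f i)) (𝒰.f i) A.X.hom :=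
    (IsPullback.of_hasPullback _ _).flip
  have s₀ := α.paste_vert β
  have s : IsPullback (pullback.snd (A.baseChange (𝒰.f i)).X.hom (E i).hat.X.hom)
      (A.prodChart 𝒰 E H χ hχ i ≫ pullback.fst A.X.hom H.X.hom) (χ i ≫ H.X.hom) A.X.hom := by
    rw [prodChart_fst, w]
    exact s₀
  have t : IsPullback (pullback.snd A.X.hom H.X.hom) (pullback.fst A.X.hom H.X.hom) H.X.hom A.X.hom :=
    (IsPullback.of_hasPullback _ _).flip
  exact IsPullback.of_bot s (A.prodChart_snd 𝒰 E H χ hχ i).symm t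

include hχ in
/-- **The hat charts are open immersions** (`χᵢ` is a base change of the open immersion `Uᵢ ↪ S`).
[cite: GortzWedhorn2020, Section (4.11)] -/
theorem isOpenImmersion_chart (i : 𝒰.I₀) : IsOpenImmersion (χ i) := by
  obtain ⟨w, hpb, -, -⟩ := hχ i
  exact MorphismProperty.of_isPullback (P := @IsOpenImmersion) hpb.flip inferInstance

/-- **The product charts are open immersions** (`Ξᵢ` is a base change of `χᵢ`, `isPullback_prodChart`).
[cite: GortzWedhorn2020, Section (4.11)] -/
theorem isOpenImmersion_prodChart (i : 𝒰.I₀) : IsOpenImmersion (A.prodChart 𝒰 E H χ hχ i) :=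
  MorphismProperty.of_isPullback (P := @IsOpenImmersion) (A.isPullback_prodChart 𝒰 E H χ hχ i)
    (A.isOpenImmersion_chart 𝒰 E H χ hχ i)

/-- **The product charts cover `A ×_S H`** as soon as the hat charts cover `H`: a point `x` of `A ×_S H` with `pr_H x = χᵢ y` lifts to
`Aᵢ ×_{Uᵢ} Êᵢ` (cartesian square, Mathlib `Scheme.Pullback.exists_preimage_pullback`). [cite: GortzWedhorn2020, Prop. 4.16 and Lemma 4.28] -/
theorem exists_prodChart_base_eq (hcov : ∀ h : H.X.left, ∃ (i : 𝒰.I₀) (y : (E i).hat.X.left), (χ i).base y = h)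
    (x : ↥(A.prodLeft H)) : ∃ (i : 𝒰.I₀) (z : ↥((A.baseChange (𝒰.f i)).prodLeft (E i).hat)), (A.prodChart 𝒰 E H χ hχ i).base z = x := by
  obtain ⟨i, y, hy⟩ := hcov ((pullback.snd A.X.hom H.X.hom).base x)
  obtain ⟨z, -, hz⟩ := Scheme.exists_preimage_of_isPullback (A.isPullback_prodChart 𝒰 E H χ hχ i) y x hy
  exact ⟨i, z, hz⟩

include hχ in
/-- **The hat charts cover `H`**: every point of `H` lies over some `Uᵢ` (the `Uᵢ` cover `S`) and lifts to `Êᵢ = H ×_S Uᵢ` (cartesian `χᵢ`,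
Mathlib `Scheme.exists_preimage_of_isPullback`). [cite: GortzWedhorn2020, Lemma 4.28] -/
theorem exists_chart_base_eq (h : ↥H.X.left) : ∃ (i : 𝒰.I₀) (y : ↥(E i).hat.X.left), (χ i).base y = h := by
  obtain ⟨i, u, hu⟩ := 𝒰.exists_eq (H.X.hom.base h)
  obtain ⟨w, hpb, -, -⟩ := hχ i
  obtain ⟨y, hy, -⟩ := Scheme.exists_preimage_of_isPullback hpb h u hu.symm
  exact ⟨i, y, hy⟩

/-- **The product charts cover `A ×_S H`** (unconditionally: the hat charts cover `H`, `exists_chart_base_eq`).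
[cite: GortzWedhorn2020, Prop. 4.16 and Lemma 4.28] -/
theorem exists_prodChart_base_eq' (x : ↥(A.prodLeft H)) :
    ∃ (i : 𝒰.I₀) (z : ↥((A.baseChange (𝒰.f i)).prodLeft (E i).hat)), (A.prodChart 𝒰 E H χ hχ i).base z = x :=
  A.exists_prodChart_base_eq 𝒰 E H χ hχ (A.exists_chart_base_eq 𝒰 E H χ hχ) x

/-- The ranges of the product charts cover `A ×_S H` (the `hcov` hypothesis of the (Z1) engine `GlueDatum.hasRank_glued` for
`U i := (prodChart i).opensRange`). [cite: GortzWedhorn2020, Prop. 4.16 and Lemma 4.28] -/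
theorem exists_mem_opensRange_prodChart (x : ↥(A.prodLeft H)) :
    ∃ i : 𝒰.I₀, x ∈ @Scheme.Hom.opensRange _ _ (A.prodChart 𝒰 E H χ hχ i) (A.isOpenImmersion_prodChart 𝒰 E H χ hχ i) := by
  obtain ⟨i, z, hz⟩ := A.exists_prodChart_base_eq' 𝒰 E H χ hχ x
  exact ⟨i, z, hz⟩

end AbelianSchemeOver

end Literature.AlgebraicGeometry.AbelianSchemes

end
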